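import Literature.Analysis.FluidPDE.GallayWayneProfileRegularity
import Mathlib.Topology.ContinuousMap.Bounded.Normed
import Mathlib.Topology.MetricSpace.Contracting
import HarnessLib

/-!
# Existence of bounded solutions of the Gallay–Wayne cell-profile equation

For a continuous, integrable weight `h ≥ 0` on `ℝ` satisfying the mass condition

  `m(t) := |∫₀ᵗ h| + ∫ₜ^∞ h ≤ L < 8`   for all `t`,

the affine Volterra-type map

  `(Φ E)(t) = ⅛ ( t ∫₀¹ v² h(tv)(E(tv) − ½) dv + ∫ₜ^∞ h(u)(E(u) − ½) du )`

is a contraction of ratio `L/8` of the Banach space `ℝ →ᵇ ℝ` of bounded continuous functions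
(`abs_cellOperator_le`: `|t ∫₀¹ v² h(tv) g(tv) dv + ∫ₜ^∞ h g| ≤ (sup |g|) · m(t)`), hence has a
(unique) bounded continuous fixed point (`exists_cellFixedPoint`; Banach's fixed point theorem,
Mathlib's `ContractingWith.fixedPoint`). With the Gaussian cell weight of Gallay–Wayne 2006, §3
(`h(t) = (t/4)/(e^{t/4} − 1)` for `t ≥ 0`, `∫₀^∞ h = 2π²/3 < 8`) this fixed point is (in the
variable `t = r²`, up to normalisation) the stream coefficient `Ω` of their Proposition 3.1,
there obtained from the ODE (3.6) by variation of constants ((3.9)); the contraction replaces the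
Coddington–Levinson asymptotics of loc. cit. Also the mass estimate `mass_le_of_support_of_le` used
to check the hypothesis for cut-off weights. Everything is proved; no definitions.

## References

* Th. Gallay, C. E. Wayne, *Existence and stability of asymmetric Burgers vortices*, J. Math.
  Fluid Mech. 9 (2007) = arXiv:math/0503353, §3, (3.4)–(3.9). [GallayWayne2006]
-/

noncomputable section

open Set Filter MeasureTheory intervalIntegral BoundedContinuousFunction
open scoped Topology NNReal

namespace Literature.Analysis.FluidPDE

/-! ### The basic estimate -/

section Estimate

variable {h : ℝ → ℝ} (hc : Continuous h) (h0 : ∀ t, 0 ≤ h t) (hi : Integrable h)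
include hc h0 hi

omit hc hi in
/-- `t ∫₀¹ h(tv) dv = ∫₀ᵗ h`, so `|t| ∫₀¹ h(tv) dv = |∫₀ᵗ h|`. [folklore] -/
theorem abs_mul_integral_comp_mul (t : ℝ) :
    |t| * ∫ v in (0 : ℝ)..1, h (t * v) = |∫ u in (0 : ℝ)..t, h u| := by
  have h1 : t * ∫ v in (0 : ℝ)..1, h (t * v) = ∫ u in (0 : ℝ)..t, h u := by
    have := mul_integral_comp_mul_left (a := 0) (b := 1) (c := t) (f := h)
    simpa only [mul_zero, mul_one] using this
  have hnn : 0 ≤ ∫ v in (0 : ℝ)..1, h (t * v) :=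
    intervalIntegral.integral_nonneg zero_le_one fun v _ => h0 _
  rw [← h1, abs_mul, abs_of_nonneg hnn]

/-- **The basic estimate**: for continuous `g` with `|g| ≤ G`,
`|t ∫₀¹ v² h(tv) g(tv) dv + ∫ₜ^∞ h g| ≤ G (|∫₀ᵗ h| + ∫ₜ^∞ h)`. [folklore] -/
theorem abs_cellOperator_le {g : ℝ → ℝ} (hg : Continuous g) {G : ℝ} (hG : ∀ u, |g u| ≤ G) (t : ℝ) :
    |(t * ∫ v in (0 : ℝ)..1, v ^ 2 * (h (t * v) * g (t * v))) + ∫ u in Ioi t, h u * g u| ≤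
      G * (|∫ u in (0 : ℝ)..t, h u| + ∫ u in Ioi t, h u) := by
  have hG0 : 0 ≤ G := (abs_nonneg _).trans (hG 0)
  -- the local term
  have h1 : |t * ∫ v in (0 : ℝ)..1, v ^ 2 * (h (t * v) * g (t * v))| ≤ G * |∫ u in (0 : ℝ)..t, h u| := by
    rw [abs_mul, ← abs_mul_integral_comp_mul h0 t, mul_left_comm]
    refine mul_le_mul_of_nonneg_left ?_ (abs_nonneg t)
    calc |∫ v in (0 : ℝ)..1, v ^ 2 * (h (t * v) * g (t * v))|
        ≤ ∫ v in (0 : ℝ)..1, |v ^ 2 * (h (t * v) * g (t * v))| :=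
          abs_integral_le_integral_abs zero_le_one
      _ ≤ ∫ v in (0 : ℝ)..1, G * h (t * v) := by
          refine intervalIntegral.integral_mono_on zero_le_one
            ((by fun_prop : Continuous fun v => |v ^ 2 * (h (t * v) * g (t * v))|).intervalIntegrable _ _)
            ((by fun_prop : Continuous fun v => G * h (t * v)).intervalIntegrable _ _)
            fun v hv => ?_
          rw [abs_mul, abs_mul, abs_of_nonneg (h0 _), abs_pow, abs_of_nonneg hv.1]
          calc v ^ 2 * (h (t * v) * |g (t * v)|) ≤ 1 * (h (t * v) * G) :=
                mul_le_mul (pow_le_one₀ hv.1 hv.2) (mul_le_mul_of_nonneg_left (hG _) (h0 _))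
                  (mul_nonneg (h0 _) (abs_nonneg _)) zero_le_one
            _ = G * h (t * v) := by ring
      _ = G * ∫ v in (0 : ℝ)..1, h (t * v) := intervalIntegral.integral_const_mul _ _
  -- the tail term
  have hint : Integrable fun u => h u * g u :=
    hi.mul_bdd hg.aestronglyMeasurable (Eventually.of_forall fun u => by
      rw [Real.norm_eq_abs]; exact hG u)
  have h2 : |∫ u in Ioi t, h u * g u| ≤ G * ∫ u in Ioi t, h u := by
    calc |∫ u in Ioi t, h u * g u| ≤ ∫ u in Ioi t, |h u * g u| := by
          have := norm_integral_le_integral_norm (μ := volume.restrict (Ioi t)) (fun u => h u * g u)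
          simpa only [Real.norm_eq_abs] using this
      _ ≤ ∫ u in Ioi t, G * h u := by
          refine setIntegral_mono_on hint.abs.integrableOn (hi.const_mul G).integrableOn
            measurableSet_Ioi fun u _ => ?_
          rw [abs_mul, abs_of_nonneg (h0 u), mul_comm]
          exact mul_le_mul_of_nonneg_right (hG u) (h0 u)
      _ = G * ∫ u in Ioi t, h u := integral_const_mul _ _
  calc |(t * ∫ v in (0 : ℝ)..1, v ^ 2 * (h (t * v) * g (t * v))) + ∫ u in Ioi t, h u * g u|
      ≤ |t * ∫ v in (0 : ℝ)..1, v ^ 2 * (h (t * v) * g (t * v))| + |∫ u in Ioi t, h u * g u| :=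
        abs_add_le _ _
    _ ≤ G * |∫ u in (0 : ℝ)..t, h u| + G * ∫ u in Ioi t, h u := add_le_add h1 h2
    _ = G * (|∫ u in (0 : ℝ)..t, h u| + ∫ u in Ioi t, h u) := by ring

omit h0 in
/-- The operator applied to a bounded continuous function is continuous in `t`. [folklore] -/
theorem continuous_cellOperator (E : ℝ →ᵇ ℝ) :
    Continuous fun t => 1 / 8 * ((t * ∫ v in (0 : ℝ)..1, v ^ 2 * (h (t * v) * (E (t * v) - 1 / 2))) +
      ∫ u in Ioi t, h u * (E u - 1 / 2)) := by
  have hqc : Continuous fun u => h u * (E u - 1 / 2) := by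
    have := E.continuous
    fun_prop
  have hqi : Integrable fun u => h u * (E u - 1 / 2) :=
    hi.mul_bdd (by fun_prop : Continuous fun u => E u - 1 / 2).aestronglyMeasurable
      (Eventually.of_forall fun u => by
        rw [Real.norm_eq_abs]
        calc |E u - 1 / 2| ≤ |E u| + |(1 / 2 : ℝ)| := abs_sub _ _
          _ ≤ ‖E‖ + 1 / 2 := by
              rw [abs_of_pos (by norm_num : (0 : ℝ) < 1 / 2)]
              have hn := E.norm_coe_le_norm u
              rw [Real.norm_eq_abs] at hn
              linarith)
  have h1 : Continuous fun t => t * ∫ v in (0 : ℝ)..1, v ^ 2 * (h (t * v) * (E (t * v) - 1 / 2)) :=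
    continuous_id.mul (Calculus.continuous_integral_pow_mul_comp_mul hqc 2)
  have h2 : Continuous fun t => ∫ u in Ioi t, h u * (E u - 1 / 2) :=
    continuous_iff_continuousAt.2 fun t => (hasDerivAt_integral_Ioi' hqc hqi t).continuousAt
  exact continuous_const.mul (h1.add h2)

end Estimate

/-! ### The contraction and its fixed point -/

/-- **Existence of a bounded continuous solution** of
`E(t) = ⅛ (t ∫₀¹ v² h(tv)(E(tv) − ½) dv + ∫ₜ^∞ h (E − ½))` when the mass function of the weight
`h ≥ 0` satisfies `|∫₀ᵗ h| + ∫ₜ^∞ h ≤ L < 8` (contraction of ratio `L/8` on `ℝ →ᵇ ℝ`). [folklore] -/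
theorem exists_cellFixedPoint {h : ℝ → ℝ} (hc : Continuous h) (h0 : ∀ t, 0 ≤ h t) (hi : Integrable h)
    {L : ℝ} (hL : L < 8) (hm : ∀ t, |∫ u in (0 : ℝ)..t, h u| + ∫ u in Ioi t, h u ≤ L) :
    ∃ E : ℝ → ℝ, Continuous E ∧ (∃ B, ∀ t, |E t| ≤ B) ∧
      ∀ t, E t = 1 / 8 * ((t * ∫ v in (0 : ℝ)..1, v ^ 2 * (h (t * v) * (E (t * v) - 1 / 2))) +
        ∫ u in Ioi t, h u * (E u - 1 / 2)) := by
  have hL0 : 0 ≤ L := by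
    have := hm 0
    have h1 : 0 ≤ ∫ u in Ioi (0 : ℝ), h u := setIntegral_nonneg measurableSet_Ioi fun u _ => h0 u
    simp only [intervalIntegral.integral_same, abs_zero, zero_add] at this
    linarith
  -- pointwise bound on the operator
  have hbound : ∀ (E : ℝ →ᵇ ℝ) (t : ℝ),
      ‖1 / 8 * ((t * ∫ v in (0 : ℝ)..1, v ^ 2 * (h (t * v) * (E (t * v) - 1 / 2))) +
        ∫ u in Ioi t, h u * (E u - 1 / 2))‖ ≤ L / 8 * (‖E‖ + 1 / 2) := by
    intro E t
    have hG : ∀ u, |E u - 1 / 2| ≤ ‖E‖ + 1 / 2 := fun u => by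
      calc |E u - 1 / 2| ≤ |E u| + |(1 / 2 : ℝ)| := abs_sub _ _
        _ ≤ ‖E‖ + 1 / 2 := by
            rw [abs_of_pos (by norm_num : (0 : ℝ) < 1 / 2)]
            have hn := E.norm_coe_le_norm u
            rw [Real.norm_eq_abs] at hn
            linarith
    have hE2 : Continuous fun u => E u - 1 / 2 := by have := E.continuous; fun_prop
    have hest := abs_cellOperator_le hc h0 hi hE2 hG t
    rw [Real.norm_eq_abs, abs_mul, abs_of_pos (by norm_num : (0 : ℝ) < 1 / 8)]
    have hpos : 0 ≤ ‖E‖ + 1 / 2 := by positivity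
    calc 1 / 8 * |(t * ∫ v in (0 : ℝ)..1, v ^ 2 * (h (t * v) * (E (t * v) - 1 / 2))) +
          ∫ u in Ioi t, h u * (E u - 1 / 2)|
        ≤ 1 / 8 * ((‖E‖ + 1 / 2) * L) := by
          gcongr
          exact hest.trans (mul_le_mul_of_nonneg_left (hm t) hpos)
      _ = L / 8 * (‖E‖ + 1 / 2) := by ring
  -- the map
  let Φ : (ℝ →ᵇ ℝ) → (ℝ →ᵇ ℝ) := fun E =>
    BoundedContinuousFunction.ofNormedAddCommGroup
      (fun t => 1 / 8 * ((t * ∫ v in (0 : ℝ)..1, v ^ 2 * (h (t * v) * (E (t * v) - 1 / 2))) +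
        ∫ u in Ioi t, h u * (E u - 1 / 2)))
      (continuous_cellOperator hc hi E) (L / 8 * (‖E‖ + 1 / 2)) (hbound E)
  have hΦ_apply : ∀ (E : ℝ →ᵇ ℝ) (t : ℝ), Φ E t =
      1 / 8 * ((t * ∫ v in (0 : ℝ)..1, v ^ 2 * (h (t * v) * (E (t * v) - 1 / 2))) +
        ∫ u in Ioi t, h u * (E u - 1 / 2)) := fun E t => rfl
  -- the Lipschitz estimate
  have hlip : ∀ E₁ E₂ : ℝ →ᵇ ℝ, dist (Φ E₁) (Φ E₂) ≤ L / 8 * dist E₁ E₂ := by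
    intro E₁ E₂
    rw [BoundedContinuousFunction.dist_le (by positivity)]
    intro t
    rw [Real.dist_eq, hΦ_apply, hΦ_apply]
    have hE₁ := E₁.continuous
    have hE₂ := E₂.continuous
    have hqc : ∀ E : ℝ →ᵇ ℝ, Continuous fun u => h u * (E u - 1 / 2) := fun E => by
      have := E.continuous; fun_prop
    have hqi : ∀ E : ℝ →ᵇ ℝ, Integrable fun u => h u * (E u - 1 / 2) := fun E =>
      hi.mul_bdd (by have := E.continuous; fun_prop : Continuous fun u => E u - 1 / 2).aestronglyMeasurable
        (Eventually.of_forall fun u => by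
          rw [Real.norm_eq_abs]
          calc |E u - 1 / 2| ≤ |E u| + |(1 / 2 : ℝ)| := abs_sub _ _
            _ ≤ ‖E‖ + 1 / 2 := by
                rw [abs_of_pos (by norm_num : (0 : ℝ) < 1 / 2)]
                have hn := E.norm_coe_le_norm u
                rw [Real.norm_eq_abs] at hn
                linarith)
    -- difference of the two operators = operator applied to the difference
    have hdiff : 1 / 8 * ((t * ∫ v in (0 : ℝ)..1, v ^ 2 * (h (t * v) * (E₁ (t * v) - 1 / 2))) +
          ∫ u in Ioi t, h u * (E₁ u - 1 / 2)) -
        1 / 8 * ((t * ∫ v in (0 : ℝ)..1, v ^ 2 * (h (t * v) * (E₂ (t * v) - 1 / 2))) +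
          ∫ u in Ioi t, h u * (E₂ u - 1 / 2)) =
        1 / 8 * ((t * ∫ v in (0 : ℝ)..1, v ^ 2 * (h (t * v) * (E₁ (t * v) - E₂ (t * v)))) +
          ∫ u in Ioi t, h u * (E₁ u - E₂ u)) := by
      have hv : ∫ v in (0 : ℝ)..1, v ^ 2 * (h (t * v) * (E₁ (t * v) - E₂ (t * v))) =
          (∫ v in (0 : ℝ)..1, v ^ 2 * (h (t * v) * (E₁ (t * v) - 1 / 2))) -
          ∫ v in (0 : ℝ)..1, v ^ 2 * (h (t * v) * (E₂ (t * v) - 1 / 2)) := by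
        rw [← intervalIntegral.integral_sub
          ((by fun_prop : Continuous fun v => v ^ 2 * (h (t * v) * (E₁ (t * v) - 1 / 2))).intervalIntegrable _ _)
          ((by fun_prop : Continuous fun v => v ^ 2 * (h (t * v) * (E₂ (t * v) - 1 / 2))).intervalIntegrable _ _)]
        refine intervalIntegral.integral_congr fun v _ => ?_
        ring
      have hI : ∫ u in Ioi t, h u * (E₁ u - E₂ u) =
          (∫ u in Ioi t, h u * (E₁ u - 1 / 2)) - ∫ u in Ioi t, h u * (E₂ u - 1 / 2) := by
        rw [← integral_sub (hqi E₁).integrableOn (hqi E₂).integrableOn]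
        refine integral_congr_ae (Eventually.of_forall fun u => ?_)
        ring
      rw [hv, hI]
      ring
    rw [hdiff, abs_mul, abs_of_pos (by norm_num : (0 : ℝ) < 1 / 8)]
    have hG : ∀ u, |E₁ u - E₂ u| ≤ dist E₁ E₂ := fun u => by
      rw [← Real.dist_eq]; exact E₁.dist_coe_le_dist u
    have hest := abs_cellOperator_le hc h0 hi (by fun_prop : Continuous fun u => E₁ u - E₂ u) hG t
    calc 1 / 8 * |(t * ∫ v in (0 : ℝ)..1, v ^ 2 * (h (t * v) * (E₁ (t * v) - E₂ (t * v)))) +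
          ∫ u in Ioi t, h u * (E₁ u - E₂ u)|
        ≤ 1 / 8 * (dist E₁ E₂ * L) := by
          gcongr
          exact hest.trans (mul_le_mul_of_nonneg_left (hm t) dist_nonneg)
      _ = L / 8 * dist E₁ E₂ := by ring
  have hK : ContractingWith ⟨L / 8, by positivity⟩ Φ := by
    refine ⟨?_, LipschitzWith.of_dist_le_mul fun E₁ E₂ => ?_⟩
    · change L / 8 < 1
      rw [div_lt_one (by norm_num : (0 : ℝ) < 8)]
      exact hL
    · exact hlip E₁ E₂
  set E₀ := ContractingWith.fixedPoint Φ hK with hE₀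
  have hfix : Φ E₀ = E₀ := ContractingWith.fixedPoint_isFixedPt hK
  refine ⟨E₀, E₀.continuous, ⟨‖E₀‖, fun t => ?_⟩, fun t => ?_⟩
  · rw [← Real.norm_eq_abs]; exact E₀.norm_coe_le_norm t
  · have := hΦ_apply E₀ t
    rw [hfix] at this
    exact this

/-! ### A mass estimate for cut-off weights -/

/-- **Mass estimate.** If `h ≥ 0` is integrable, vanishes on `(−∞, −δ]`, is `≤ M` on `[−δ, 0]`
and `∫₀^∞ h ≤ I`, then `|∫₀ᵗ h| + ∫ₜ^∞ h ≤ I + 2δM` for every `t`. [folklore] -/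
theorem mass_le_of_support_of_le {h : ℝ → ℝ} (h0 : ∀ t, 0 ≤ h t) (hi : Integrable h) {δ M I : ℝ}
    (hδ : 0 < δ) (hM : 0 ≤ M) (hsupp : ∀ t, t ≤ -δ → h t = 0) (hle : ∀ t, -δ ≤ t → t ≤ 0 → h t ≤ M)
    (hI : ∫ u in Ioi (0 : ℝ), h u ≤ I) (t : ℝ) :
    |∫ u in (0 : ℝ)..t, h u| + ∫ u in Ioi t, h u ≤ I + 2 * δ * M := by
  -- the negative part carries mass at most `δM`
  have hneg : ∀ s, s ≤ 0 → ∫ u in Ioc s 0, h u ≤ δ * M := by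
    intro s hs
    have hpt : ∀ u ∈ Ioc s 0, h u ≤ (Icc (-δ) 0).indicator (fun _ => M) u := by
      intro u hu
      rw [Set.indicator_apply]
      by_cases hu' : -δ ≤ u
      · rw [if_pos (show u ∈ Icc (-δ) 0 from ⟨hu', hu.2⟩)]
        exact hle u hu' hu.2
      · rw [if_neg (fun h' : u ∈ Icc (-δ) 0 => hu' h'.1), hsupp u (le_of_lt (not_le.1 hu'))]
    have hind : Integrable ((Icc (-δ) 0).indicator fun _ => M) :=
      (integrableOn_const (C := M) (show volume (Icc (-δ) (0 : ℝ)) ≠ ⊤ from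
        measure_Icc_lt_top.ne)).integrable_indicator measurableSet_Icc
    calc ∫ u in Ioc s 0, h u ≤ ∫ u in Ioc s 0, (Icc (-δ) 0).indicator (fun _ => M) u :=
          setIntegral_mono_on hi.integrableOn hind.integrableOn measurableSet_Ioc hpt
      _ ≤ ∫ u, (Icc (-δ) 0).indicator (fun _ => M) u :=
          setIntegral_le_integral hind (Eventually.of_forall fun u =>
            indicator_nonneg (fun _ _ => hM) u)
      _ = δ * M := by
          rw [integral_indicator_const _ measurableSet_Icc, Real.volume_real_Icc, smul_eq_mul]
          simp [hδ.le]
  have hIoi0 : 0 ≤ ∫ u in Ioi (0 : ℝ), h u := setIntegral_nonneg measurableSet_Ioi fun u _ => h0 u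
  rcases le_or_gt 0 t with ht | ht
  · -- `t ≥ 0`: the two pieces add up to `∫₀^∞ h`
    have h1 : ∫ u in (0 : ℝ)..t, h u = ∫ u in Ioc 0 t, h u := intervalIntegral.integral_of_le ht
    have h2 : (∫ u in Ioc 0 t, h u) + ∫ u in Ioi t, h u = ∫ u in Ioi 0, h u := by
      rw [← setIntegral_union Ioc_disjoint_Ioi_same measurableSet_Ioi hi.integrableOn hi.integrableOn,
        Ioc_union_Ioi_eq_Ioi ht]
    have h3 : 0 ≤ ∫ u in Ioc 0 t, h u := setIntegral_nonneg measurableSet_Ioc fun u _ => h0 u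
    rw [h1, abs_of_nonneg h3, h2]
    nlinarith
  · -- `t < 0`
    have h1 : ∫ u in (0 : ℝ)..t, h u = -∫ u in Ioc t 0, h u := by
      rw [intervalIntegral.integral_symm, intervalIntegral.integral_of_le ht.le]
    have h2 : ∫ u in Ioi t, h u = (∫ u in Ioc t 0, h u) + ∫ u in Ioi 0, h u := by
      rw [← setIntegral_union Ioc_disjoint_Ioi_same measurableSet_Ioi hi.integrableOn hi.integrableOn,
        Ioc_union_Ioi_eq_Ioi ht.le]
    have h3 : 0 ≤ ∫ u in Ioc t 0, h u := setIntegral_nonneg measurableSet_Ioc fun u _ => h0 u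
    have h4 := hneg t ht.le
    rw [h1, abs_neg, abs_of_nonneg h3, h2]
    linarith

end Literature.Analysis.FluidPDE
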